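import Mathlib.Data.Real.Basic
import Mathlib.Tactic.Linarith
import Mathlib.Tactic.Ring
import Mathlib.Tactic.FieldSimp
import Mathlib.Tactic.Positivity
import Mathlib.Tactic.LinearCombination
import HarnessLib
import Summits.CriticalPhenomena.PercolationContinuityZ3.Theorems.PercNearOneGluingNoHeavyQuantGatedSliceMixLawQKIneq
import Summits.CriticalPhenomena.PercolationContinuityZ3.Theorems.PercNearOneGluingNoHeavyQuantGatedSliceMixLawQKIneqLHCertsA
import Summits.CriticalPhenomena.PercolationContinuityZ3.Theorems.PercNearOneGluingNoHeavyQuantGatedSliceMixLawQKIneqLHCertsB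
import Summits.CriticalPhenomena.PercolationContinuityZ3.Theorems.PercNearOneGluingNoHeavyQuantGatedSliceMixLawQKIneqLHCertsC

/-!
# QUANT lane R8, (III) blob case — cell QK, class LM: the inequality `qk_Ib_lh`

See `…QKIneqLHDefs` for the statement, the reduction `(Ib) ⟸ T(y) ≥ 0` and the plan.  Here: the endpoint consequences
(`T(mg) ≥ 0`, `T(S/k₂) ≥ 0`, `T'(S/k₂) ≤ 0` from the certificates of parts A–C), the value `T(W₂/d₂) ≥ 0` from the heavy-top
inequality `qk_Ib_heavyTop` (R4), and the assembly (`Δ₀ ≤ 0` termwise; `Δ₀ > 0` by convexity/concavity of `T` in `y`).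

builds on p205010 (kernel theorem, internal audit signed; external expert review pending)

Support file (`--supports stmt-CriticalPhenomena-4575`), QUANT lane seat prim-quant-arm-1 (gen 41), rung R8 of `run/shared/lean/prim/quant/LADDER.md`.
HONEST STATUS: `GatedSliceMixLaw'` (regime R), CW, `GateMove`, `GatedConvEmptyFree`, `SingleGateConvClosed`, `TreeDEC`, `FarTreeRow` OPEN; RATE unchanged.
[this work].  Nothing here is cited as a published result.
-/

namespace Summit.CriticalPhenomena.PercolationContinuityZ3.Theorems

namespace Quant

namespace LawDec

/-! ### endpoint consequences -/

/-- `T(mg) ≥ 0` (mg branch: `mg·k₂ ≤ S`). -/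
theorem qk_lh_T_Y_mg (z g lam S k₁ k₂ a : ℝ) (hz0 : 0 ≤ z) (hz1 : z < 1) (hg0 : 0 ≤ g) (hg1 : g ≤ 1) (hlam0 : 0 ≤ lam) (hlam1 : lam ≤ 1)
    (hk₁ : 0 ≤ k₁) (hk : k₁ + 1 ≤ k₂) (hmean : (1 - z) * (k₁ + (k₂ - k₁) * lam) = S) (hD0 : 0 ≤ S - 2 * k₁)
    (hmg0 : 0 < (1 - z) * g) (hW2 : 0 < S + a * g * (1 - z) - 2 * k₂)
    (hR2 : 0 ≤ 2 * k₂ - S - (1 - z) * g * (k₂ - k₁)) (hta : (1 - z) * g * k₂ ≤ S)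
    (hpos : 0 ≤ ((1 - z) * g) * (1 - (1 - z) * (1 - lam) * g - (1 - z) * lam * (1 - g)) - (1 - z) * lam * g) :
    0 ≤ qkT ((1 - z) * g) z g lam S k₁ k₂ a := by
  have hA := qkFA_nonneg z g lam S k₁ k₂ hz0 hz1 hg0 hg1 hlam0 hlam1 hk₁ hk hmean hD0 hta hR2 hpos
  have hB := qkFB_nonneg z g lam S k₁ k₂ hz0 hz1 hg0 hg1 hlam0 hlam1 hk₁ hk hmean hD0 hta hR2 hpos
  have e := qkT_mg_split z g lam S k₁ k₂ a
  have h1 : 0 ≤ (S + a * g * (1 - z) - 2 * k₂) * qkFA z g lam S k₁ k₂ := mul_nonneg hW2.le hA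
  have h2 : 0 ≤ (2 * k₂ - S - (1 - z) * g * (k₂ - k₁)) * qkFB z g lam S k₁ k₂ := mul_nonneg hR2 hB
  by_contra hc
  have := mul_neg_of_pos_of_neg hmg0 (not_le.1 hc)
  linarith

/-- `T(S/k₂) ≥ 0` (S/K branch: `S ≤ mg·k₂`). -/
theorem qk_lh_T_Y_sk (Y z g lam S k₁ k₂ a : ℝ) (hz0 : 0 ≤ z) (hz1 : z < 1) (hg0 : 0 ≤ g) (hg1 : g ≤ 1) (hlam0 : 0 ≤ lam) (hlam1 : lam ≤ 1)
    (hk₁ : 0 ≤ k₁) (hk : k₁ + 1 ≤ k₂) (hmean : (1 - z) * (k₁ + (k₂ - k₁) * lam) = S) (hD0 : 0 ≤ S - 2 * k₁)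
    (hmg0 : 0 < (1 - z) * g) (hW2 : 0 < S + a * g * (1 - z) - 2 * k₂)
    (hY : Y * k₂ = S) (hY0 : 0 ≤ Y) (hY1 : 0 ≤ 1 - Y) (hR2 : 0 ≤ 2 * k₂ - S - (1 - z) * g * (k₂ - k₁)) (htaY : Y ≤ (1 - z) * g)
    (hpos : 0 ≤ Y * (1 - (1 - z) * (1 - lam) * g - (1 - z) * lam * (1 - g)) - (1 - z) * lam * g) :
    0 ≤ qkT Y z g lam S k₁ k₂ a := by
  have hC := qkFC_nonneg Y z g lam S k₁ k₂ hz0 hz1 hg0 hg1 hlam0 hlam1 hk₁ hk hmean hD0 hY hY0 hY1 htaY hR2 hpos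
  have hD := qkFD_nonneg Y z g lam S k₁ k₂ hz0 hz1 hg0 hg1 hlam0 hlam1 hk₁ hk hmean hD0 hY hY0 hY1 htaY hR2 hpos
  have h2 := qkTa2_nonneg Y z g lam hz1.le hg0 hg1 hlam0 hY0 (by linarith) htaY
  have e := qkT_sk_split Y z g lam S k₁ k₂ a
  have h1 : 0 ≤ (S + a * g * (1 - z) - 2 * k₂) * qkFD Y z g lam S k₁ k₂ := mul_nonneg hW2.le hD
  have h3 : 0 ≤ qkTa2 Y z g lam * (S + a * g * (1 - z) - 2 * k₂) ^ 2 := mul_nonneg h2 (sq_nonneg _)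
  by_contra hc
  have := mul_neg_of_pos_of_neg (pow_pos hmg0 2) (not_le.1 hc)
  linarith

/-- `T'(S/k₂) ≤ 0` (S/K branch). -/
theorem qk_lh_D_Y_sk (Y z g lam S k₁ k₂ a : ℝ) (hz0 : 0 ≤ z) (hz1 : z < 1) (hg0 : 0 ≤ g) (hg1 : g ≤ 1) (hlam0 : 0 ≤ lam) (hlam1 : lam ≤ 1)
    (hk₁ : 0 ≤ k₁) (hk : k₁ + 1 ≤ k₂) (hmean : (1 - z) * (k₁ + (k₂ - k₁) * lam) = S) (hD0 : 0 ≤ S - 2 * k₁)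
    (hmg0 : 0 < (1 - z) * g) (hW2 : 0 < S + a * g * (1 - z) - 2 * k₂)
    (hY : Y * k₂ = S) (hY0 : 0 ≤ Y) (hY1 : 0 ≤ 1 - Y) (hR2 : 0 ≤ 2 * k₂ - S - (1 - z) * g * (k₂ - k₁)) (htaY : Y ≤ (1 - z) * g)
    (hpos : 0 ≤ Y * (1 - (1 - z) * (1 - lam) * g - (1 - z) * lam * (1 - g)) - (1 - z) * lam * g) :
    qkD Y z g lam S k₁ k₂ a ≤ 0 := by
  have hE := qkFE_nonneg Y z g lam S k₁ k₂ hz0 hz1 hg0 hg1 hlam0 hlam1 hk₁ hk hmean hD0 hY hY0 hY1 htaY hR2 hpos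
  have hF := qkFF_nonneg Y z g lam S k₁ k₂ hz0 hz1 hg0 hg1 hlam0 hlam1 hk₁ hk hmean hD0 hY hY0 hY1 htaY hR2 hpos
  have h2 := qkNa2_nonneg Y z g lam hz0 hz1.le hg0 hg1 hlam0 hY0 htaY hmg0
  have e := qkD_sk_split Y z g lam S k₁ k₂ a
  have h1 : 0 ≤ (S + a * g * (1 - z) - 2 * k₂) * qkFF Y z g lam S k₁ k₂ := mul_nonneg hW2.le hF
  have h3 : 0 ≤ qkNa2 Y z g lam * (S + a * g * (1 - z) - 2 * k₂) ^ 2 := mul_nonneg h2 (sq_nonneg _)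
  by_contra hc
  have := mul_pos (pow_pos hmg0 2) (not_le.1 hc)
  linarith

/-! ### the inequality -/

/-! ### the inequality -/

/-- `2d₂·R = Q·T + (p+k₁)·y·C·(yd₂ − W₂)(d₂ − yd₂ + W₂)` (reduction of (Ib) to `T ≥ 0`). -/
theorem qkT_reduce (y z g lam S k₁ k₂ a : ℝ) :
    2 * (k₁ + a - k₂) * (y * (k₁ + a - (S + a * g * (1 - z)) + k₁)
          * ((1 - z) * (1 - lam) * g * ((k₁ + a - k₂) - y * y * (k₁ + a - k₂) - (1 - y) * (S + a * g * (1 - z) - 2 * k₂))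
             - (y * y * (k₁ + a - k₂) + (1 - y) * (S + a * g * (1 - z) - 2 * k₂)) * ((1 - z) * lam * (1 - g)))
        - (S + a * g * (1 - z) - 2 * k₁) * (y * (1 - (1 - z) * (1 - lam) * g - (1 - z) * lam * (1 - g)) - (1 - z) * lam * g)
          * ((k₁ + a - k₂) - y * y * (k₁ + a - k₂) - (1 - y) * (S + a * g * (1 - z) - 2 * k₂)))
      = ((k₁ + a - k₂) + y * (k₁ + a - k₂) - (S + a * g * (1 - z) - 2 * k₂)) * qkT y z g lam S k₁ k₂ a
        + (k₁ + a - (S + a * g * (1 - z)) + k₁) * y * ((1 - z) * lam * (1 - g))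
          * (y * (k₁ + a - k₂) - (S + a * g * (1 - z) - 2 * k₂)) * ((k₁ + a - k₂) - y * (k₁ + a - k₂) + (S + a * g * (1 - z) - 2 * k₂)) := by
  unfold qkT; ring

/-- `T` regrouped for the case `Δ₀ = S − 2k₁ ≤ 0`. -/
theorem qkT_regroup (y z g lam S k₁ k₂ a : ℝ) :
    qkT y z g lam S k₁ k₂ a
      = 2 * ((1 - z) * g - y) * (k₁ + a - k₂) * (a * ((1 - z) * lam * (1 - g) * y + (1 - z) * lam * g * (1 - y)) - (S - 2 * k₁) * y)
        + (k₁ + a - (S + a * g * (1 - z)) + k₁) * y * ((1 - z) * lam * (1 - g)) * (y * (k₁ + a - k₂) - (S + a * g * (1 - z) - 2 * k₂))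
        - 2 * (k₁ + a - k₂) * (S - 2 * k₁) * (y * (1 - (1 - z) * (1 - lam) * g - (1 - z) * lam * (1 - g)) - (1 - z) * lam * g) := by
  unfold qkT; ring

/-- `T` at a balanced top (`Y·d₂ = W₂`): the `C`-term vanishes. -/
theorem qkT_at_pin (Y z g lam S k₁ k₂ a : ℝ) (hpin : Y * (k₁ + a - k₂) = S + a * g * (1 - z) - 2 * k₂) :
    qkT Y z g lam S k₁ k₂ a = 2 * (k₁ + a - k₂) * (((k₁ + a - (S + a * g * (1 - z))) + k₁) * Y * ((1 - z) * g - Y)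
      - ((S + a * g * (1 - z) - 2 * k₁) - Y * a) * (Y * (1 - (1 - z) * (1 - lam) * g - (1 - z) * lam * (1 - g)) - (1 - z) * lam * g)) := by
  unfold qkT; linear_combination (((k₁ + a - (S + a * g * (1 - z))) + k₁) * Y * ((1 - z) * lam * (1 - g))) * hpin

/-- `p·T(W₂/d₂) = 2(p+k₁)·H4 + 2q·X₂·k₁(t − k₁ + p)`, where `H4 ≥ 0` is the heavy-top inequality (R4) at `y = W₂/d₂`. -/
theorem qkT_at_rho2 (z g lam S k₁ k₂ a : ℝ) (hd : k₁ + a - k₂ ≠ 0) :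
    (k₁ + a - (S + a * g * (1 - z))) * qkT ((S + a * g * (1 - z) - 2 * k₂) / (k₁ + a - k₂)) z g lam S k₁ k₂ a
      = 2 * ((k₁ + a - (S + a * g * (1 - z))) + k₁)
          * ((S + a * g * (1 - z) - 2 * k₂) / (k₁ + a - k₂) * (k₁ + a - (S + a * g * (1 - z)))
              * ((1 - z) * (1 - lam) * g * (k₁ + a - (S + a * g * (1 - z)) + k₂) - (S + a * g * (1 - z) - 2 * k₂) * ((1 - z) * lam * (1 - g)))
            - ((S + a * g * (1 - z)) - k₁)
              * ((S + a * g * (1 - z) - 2 * k₂) / (k₁ + a - k₂) * (1 - (1 - z) * (1 - lam) * g - (1 - z) * lam * (1 - g)) - (1 - z) * lam * g)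
              * (k₁ + a - (S + a * g * (1 - z)) + k₂))
        + 2 * (k₁ + a - (S + a * g * (1 - z)) + k₂)
          * ((S + a * g * (1 - z) - 2 * k₂) / (k₁ + a - k₂) * (1 - (1 - z) * (1 - lam) * g - (1 - z) * lam * (1 - g)) - (1 - z) * lam * g)
          * k₁ * ((S + a * g * (1 - z)) - k₁ + (k₁ + a - (S + a * g * (1 - z)))) := by
  unfold qkT; field_simp; ring

set_option maxHeartbeats 1600000 in
/-- **(Ib) for the top light and the low heavy at the twin** (see the file header). [this work] -/
theorem qk_Ib_lh (y z g lam S k₁ k₂ a : ℝ) (hy0 : 0 < y) (hy1 : y < 1) (hz0 : 0 ≤ z) (hz1 : z < 1) (hg0 : 0 ≤ g) (hg1 : g ≤ 1)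
    (hlam0 : 0 ≤ lam) (hlam1 : lam ≤ 1) (hyg : y ≤ (1 - z) * g) (hk₁ : 1 ≤ k₁) (hk : k₁ + 1 ≤ k₂) (hKa : k₂ + 1 ≤ a)
    (hmean : (1 - z) * (k₁ + (k₂ - k₁) * lam) = S) (hta : y * k₂ ≤ S)
    (hPt : S + a * g * (1 - z) < k₁ + a) (hW : 0 < S + a * g * (1 - z) - 2 * k₂)
    (hlightK : S + a * g * (1 - z) - 2 * k₂ < y * (k₁ + a - k₂)) (hheavyk : y * a ≤ S + a * g * (1 - z) - 2 * k₁)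
    (hX : 0 ≤ y * (1 - (1 - z) * (1 - lam) * g - (1 - z) * lam * (1 - g)) - (1 - z) * lam * g) :
    (S + a * g * (1 - z) - 2 * k₁) * (y * (1 - (1 - z) * (1 - lam) * g - (1 - z) * lam * (1 - g)) - (1 - z) * lam * g)
        * ((k₁ + a - k₂) - y * y * (k₁ + a - k₂) - (1 - y) * (S + a * g * (1 - z) - 2 * k₂))
      ≤ y * (k₁ + a - (S + a * g * (1 - z)) + k₁)
          * ((1 - z) * (1 - lam) * g * ((k₁ + a - k₂) - y * y * (k₁ + a - k₂) - (1 - y) * (S + a * g * (1 - z) - 2 * k₂))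
             - (y * y * (k₁ + a - k₂) + (1 - y) * (S + a * g * (1 - z) - 2 * k₂)) * ((1 - z) * lam * (1 - g))) := by
  have h1z : 0 < 1 - z := by linarith
  have hC0 : 0 ≤ (1 - z) * lam * (1 - g) := mul_nonneg (mul_nonneg h1z.le hlam0) (by linarith)
  have hD0c : 0 ≤ (1 - z) * lam * g := mul_nonneg (mul_nonneg h1z.le hlam0) hg0
  have hB0 : 0 ≤ (1 - z) * (1 - lam) * g := mul_nonneg (mul_nonneg h1z.le (by linarith)) hg0
  have hd₂0 : 0 < k₁ + a - k₂ := by linarith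
  have hpk0 : 0 < k₁ + a - (S + a * g * (1 - z)) + k₁ := by linarith
  have hyd : S + a * g * (1 - z) - 2 * k₂ < y * (k₁ + a - k₂) := hlightK
  have hyd1 : y * (k₁ + a - k₂) ≤ 1 * (k₁ + a - k₂) := mul_le_mul_of_nonneg_right hy1.le hd₂0.le
  have hQ0 : 0 < (k₁ + a - k₂) + y * (k₁ + a - k₂) - (S + a * g * (1 - z) - 2 * k₂) := by linarith
  have hmg0 : 0 < (1 - z) * g := lt_of_lt_of_le hy0 hyg
  -- Step 1: reduce to `T(y) ≥ 0` via `2 d₂ · R = Q · T + (p+k₁) y C (y d₂ − W₂)(d₂ − y d₂ + W₂)`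
  have hRs := qkT_reduce y z g lam S k₁ k₂ a
  suffices hT : 0 ≤ qkT y z g lam S k₁ k₂ a by
    have h1 : 0 ≤ ((k₁ + a - k₂) + y * (k₁ + a - k₂) - (S + a * g * (1 - z) - 2 * k₂)) * qkT y z g lam S k₁ k₂ a := mul_nonneg hQ0.le hT
    have h2 : 0 ≤ (k₁ + a - (S + a * g * (1 - z)) + k₁) * y * ((1 - z) * lam * (1 - g))
          * (y * (k₁ + a - k₂) - (S + a * g * (1 - z) - 2 * k₂)) * ((k₁ + a - k₂) - y * (k₁ + a - k₂) + (S + a * g * (1 - z) - 2 * k₂)) :=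
      mul_nonneg (mul_nonneg (mul_nonneg (mul_nonneg hpk0.le hy0.le) hC0) (by linarith)) (by linarith)
    have h3 : 0 ≤ 2 * (k₁ + a - k₂) * (y * (k₁ + a - (S + a * g * (1 - z)) + k₁)
          * ((1 - z) * (1 - lam) * g * ((k₁ + a - k₂) - y * y * (k₁ + a - k₂) - (1 - y) * (S + a * g * (1 - z) - 2 * k₂))
             - (y * y * (k₁ + a - k₂) + (1 - y) * (S + a * g * (1 - z) - 2 * k₂)) * ((1 - z) * lam * (1 - g)))
        - (S + a * g * (1 - z) - 2 * k₁) * (y * (1 - (1 - z) * (1 - lam) * g - (1 - z) * lam * (1 - g)) - (1 - z) * lam * g)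
          * ((k₁ + a - k₂) - y * y * (k₁ + a - k₂) - (1 - y) * (S + a * g * (1 - z) - 2 * k₂))) := by
      rw [hRs]; exact add_nonneg h1 h2
    have h4 : 0 ≤ (y * (k₁ + a - (S + a * g * (1 - z)) + k₁)
          * ((1 - z) * (1 - lam) * g * ((k₁ + a - k₂) - y * y * (k₁ + a - k₂) - (1 - y) * (S + a * g * (1 - z) - 2 * k₂))
             - (y * y * (k₁ + a - k₂) + (1 - y) * (S + a * g * (1 - z) - 2 * k₂)) * ((1 - z) * lam * (1 - g)))
        - (S + a * g * (1 - z) - 2 * k₁) * (y * (1 - (1 - z) * (1 - lam) * g - (1 - z) * lam * (1 - g)) - (1 - z) * lam * g)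
          * ((k₁ + a - k₂) - y * y * (k₁ + a - k₂) - (1 - y) * (S + a * g * (1 - z) - 2 * k₂))) := by
      by_contra hc
      have := mul_neg_of_pos_of_neg (by linarith : (0:ℝ) < 2 * (k₁ + a - k₂)) (not_le.1 hc)
      linarith
    linarith
  -- Step 2: `T(y) ≥ 0`
  by_cases hD0 : S - 2 * k₁ ≤ 0
  · -- case `Δ₀ ≤ 0`: termwise
    have e := qkT_regroup y z g lam S k₁ k₂ a
    rw [e]
    have q1 : 0 ≤ a * ((1 - z) * lam * (1 - g) * y + (1 - z) * lam * g * (1 - y)) :=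
      mul_nonneg (by linarith) (add_nonneg (mul_nonneg hC0 hy0.le) (mul_nonneg hD0c (by linarith)))
    have q2 : 0 ≤ -((S - 2 * k₁) * y) := by
      have := mul_nonpos_of_nonpos_of_nonneg hD0 hy0.le; linarith
    have p1 : 0 ≤ 2 * ((1 - z) * g - y) * (k₁ + a - k₂) * (a * ((1 - z) * lam * (1 - g) * y + (1 - z) * lam * g * (1 - y)) - (S - 2 * k₁) * y) :=
      mul_nonneg (mul_nonneg (by linarith) hd₂0.le) (by linarith)
    have p2 : 0 ≤ (k₁ + a - (S + a * g * (1 - z)) + k₁) * y * ((1 - z) * lam * (1 - g)) * (y * (k₁ + a - k₂) - (S + a * g * (1 - z) - 2 * k₂)) :=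
      mul_nonneg (mul_nonneg (mul_nonneg hpk0.le hy0.le) hC0) (by linarith)
    have p3 : 0 ≤ -(2 * (k₁ + a - k₂) * (S - 2 * k₁) * (y * (1 - (1 - z) * (1 - lam) * g - (1 - z) * lam * (1 - g)) - (1 - z) * lam * g)) := by
      have := mul_nonneg (mul_nonneg (by linarith : (0:ℝ) ≤ 2 * (k₁ + a - k₂)) (by linarith : (0:ℝ) ≤ -(S - 2 * k₁))) hX
      linarith [show 2 * (k₁ + a - k₂) * (-(S - 2 * k₁)) * (y * (1 - (1 - z) * (1 - lam) * g - (1 - z) * lam * (1 - g)) - (1 - z) * lam * g)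
        = -(2 * (k₁ + a - k₂) * (S - 2 * k₁) * (y * (1 - (1 - z) * (1 - lam) * g - (1 - z) * lam * (1 - g)) - (1 - z) * lam * g)) by ring]
    linarith
  · -- case `Δ₀ > 0`: `T(Y₂) ≥ 0`, `T(Y) ≥ 0`, `T'(Y) ≤ 0` (`Y₂ = W₂/d₂ < y ≤ Y = min(mg, S/k₂)`), then convexity / concavity in `y`
    have hD0' : 0 ≤ S - 2 * k₁ := (not_le.1 hD0).le
    have hp : 0 < k₁ + a - (S + a * g * (1 - z)) := by linarith
    have hE0 : 0 ≤ 1 - (1 - z) * (1 - lam) * g - (1 - z) * lam * (1 - g) := by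
      have h1 : (1 - z) * (1 - lam) * g ≤ (1 - lam) * 1 := by
        have := mul_le_mul (mul_le_of_le_one_left (by linarith : (0:ℝ) ≤ 1 - lam) (by linarith : 1 - z ≤ 1)) hg1 hg0 (by linarith)
        linarith
      have h2 : (1 - z) * lam * (1 - g) ≤ lam * 1 := by
        have := mul_le_mul (mul_le_of_le_one_left hlam0 (by linarith : 1 - z ≤ 1)) (by linarith : 1 - g ≤ 1) (by linarith) hlam0
        linarith
      linarith
    have hXmono : ∀ Y : ℝ, y ≤ Y → 0 ≤ Y * (1 - (1 - z) * (1 - lam) * g - (1 - z) * lam * (1 - g)) - (1 - z) * lam * g := by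
      intro Y hyY
      have : y * (1 - (1 - z) * (1 - lam) * g - (1 - z) * lam * (1 - g)) ≤ Y * (1 - (1 - z) * (1 - lam) * g - (1 - z) * lam * (1 - g)) :=
        mul_le_mul_of_nonneg_right hyY hE0
      linarith
    -- the lower end `Y₂ = W₂/d₂` and `T(Y₂) ≥ 0`
    set Y₂ : ℝ := (S + a * g * (1 - z) - 2 * k₂) / (k₁ + a - k₂) with hY₂def
    have hY₂ : Y₂ * (k₁ + a - k₂) = S + a * g * (1 - z) - 2 * k₂ := by rw [hY₂def]; field_simp
    have hY₂y : Y₂ < y := by rw [hY₂def, div_lt_iff₀ hd₂0]; linarith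
    have hY₂0 : 0 ≤ Y₂ := div_nonneg hW.le hd₂0.le
    have hY₂mg : Y₂ ≤ (1 - z) * g := by linarith
    have hY₂K : Y₂ * k₂ ≤ S := by
      have : Y₂ * k₂ ≤ y * k₂ := mul_le_mul_of_nonneg_right hY₂y.le (by linarith)
      linarith
    have hY₂a : Y₂ * a ≤ S + a * g * (1 - z) - 2 * k₁ := by
      have : Y₂ * a ≤ y * a := mul_le_mul_of_nonneg_right hY₂y.le (by linarith)
      linarith
    have hT2 : 0 ≤ qkT Y₂ z g lam S k₁ k₂ a := by
      -- at `y = Y₂` the term `C·(Y₂ d₂ − W₂)` vanishes: `T(Y₂) = 2 d₂ ((p+k₁) Y₂ σ₂ − (W₁ − Y₂ a) X₂)`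
      have eT := qkT_at_pin Y₂ z g lam S k₁ k₂ a hY₂
      by_cases hX2 : Y₂ * (1 - (1 - z) * (1 - lam) * g - (1 - z) * lam * (1 - g)) - (1 - z) * lam * g ≤ 0
      · rw [eT]
        have q1 : 0 ≤ ((k₁ + a - (S + a * g * (1 - z))) + k₁) * Y₂ * ((1 - z) * g - Y₂) := mul_nonneg (mul_nonneg hpk0.le hY₂0) (by linarith)
        have q2 : ((S + a * g * (1 - z) - 2 * k₁) - Y₂ * a) * (Y₂ * (1 - (1 - z) * (1 - lam) * g - (1 - z) * lam * (1 - g)) - (1 - z) * lam * g) ≤ 0 :=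
          mul_nonpos_of_nonneg_of_nonpos (by linarith) hX2
        exact mul_nonneg (by linarith) (by linarith)
      · have hX2' : 0 ≤ Y₂ * (1 - (1 - z) * (1 - lam) * g - (1 - z) * lam * (1 - g)) - (1 - z) * lam * g := (not_le.1 hX2).le
        -- heavy-top inequality (R4) at `y = Y₂`
        have h4 := qk_Ib_heavyTop Y₂ z g lam S k₁ k₂ a hY₂0 hz0 hz1.le hg0 hg1 hlam0 (by linarith) (by linarith) hmean hW (by linarith) hY₂.le
        -- `p·T(Y₂) = 2 (p+k₁)·H4 + 2 q X₂ k₁ (t − k₁ + p)`, `H4 ≥ 0` by (R4)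
        have eP := qkT_at_rho2 z g lam S k₁ k₂ a hd₂0.ne'
        rw [← hY₂def] at eP
        have g1 : 0 ≤ 2 * ((k₁ + a - (S + a * g * (1 - z))) + k₁)
                * (Y₂ * (k₁ + a - (S + a * g * (1 - z)))
                    * ((1 - z) * (1 - lam) * g * (k₁ + a - (S + a * g * (1 - z)) + k₂) - (S + a * g * (1 - z) - 2 * k₂) * ((1 - z) * lam * (1 - g)))
                  - ((S + a * g * (1 - z)) - k₁) * (Y₂ * (1 - (1 - z) * (1 - lam) * g - (1 - z) * lam * (1 - g)) - (1 - z) * lam * g)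
                    * (k₁ + a - (S + a * g * (1 - z)) + k₂)) := mul_nonneg (by linarith) (by linarith [h4])
        have g2 : 0 ≤ 2 * (k₁ + a - (S + a * g * (1 - z)) + k₂) * (Y₂ * (1 - (1 - z) * (1 - lam) * g - (1 - z) * lam * (1 - g)) - (1 - z) * lam * g)
                * k₁ * ((S + a * g * (1 - z)) - k₁ + (k₁ + a - (S + a * g * (1 - z)))) :=
          mul_nonneg (mul_nonneg (mul_nonneg (by linarith) hX2') (by linarith)) (by linarith)
        by_contra hc
        have := mul_neg_of_pos_of_neg hp (not_le.1 hc)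
        linarith
    -- convexity / concavity in `y` on `[Y₂, Y]`
    have conclude : ∀ Y : ℝ, y ≤ Y → 0 ≤ qkT Y z g lam S k₁ k₂ a → qkD Y z g lam S k₁ k₂ a ≤ 0 → 0 ≤ qkT y z g lam S k₁ k₂ a := by
      intro Y hyY hTY hDY
      by_cases hlead : 0 ≤ qkLead z g lam S k₁ k₂ a
      · rw [qkT_taylor y Y z g lam S k₁ k₂ a]
        have h1 : 0 ≤ -((Y - y) * qkD Y z g lam S k₁ k₂ a) := by
          have := mul_nonpos_of_nonneg_of_nonpos (sub_nonneg.2 hyY) hDY; linarith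
        have h2 : 0 ≤ qkLead z g lam S k₁ k₂ a * (Y - y) ^ 2 := mul_nonneg hlead (sq_nonneg _)
        linarith
      · have hl : qkLead z g lam S k₁ k₂ a ≤ 0 := (not_le.1 hlead).le
        have e := qkT_chord y Y Y₂ z g lam S k₁ k₂ a
        have h1 : 0 ≤ (Y - y) * qkT Y₂ z g lam S k₁ k₂ a := mul_nonneg (sub_nonneg.2 hyY) hT2
        have h2 : 0 ≤ (y - Y₂) * qkT Y z g lam S k₁ k₂ a := mul_nonneg (by linarith) hTY
        have h3 : qkLead z g lam S k₁ k₂ a * (y - Y₂) * (Y - y) * (Y - Y₂) ≤ 0 := by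
          have : 0 ≤ (y - Y₂) * (Y - y) * (Y - Y₂) := mul_nonneg (mul_nonneg (by linarith) (by linarith)) (by linarith)
          have := mul_nonpos_of_nonpos_of_nonneg hl this
          linarith [show qkLead z g lam S k₁ k₂ a * (y - Y₂) * (Y - y) * (Y - Y₂) = qkLead z g lam S k₁ k₂ a * ((y - Y₂) * (Y - y) * (Y - Y₂)) by ring]
        have hpos : 0 < Y - Y₂ := by linarith
        by_contra hc
        have := mul_neg_of_pos_of_neg hpos (not_le.1 hc)
        linarith
    have hrho : S + a * g * (1 - z) - 2 * k₂ ≤ (1 - z) * g * (k₁ + a - k₂) := by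
      have : y * (k₁ + a - k₂) ≤ (1 - z) * g * (k₁ + a - k₂) := mul_le_mul_of_nonneg_right hyg hd₂0.le
      linarith
    have hR2 : 0 ≤ 2 * k₂ - S - (1 - z) * g * (k₂ - k₁) := by linarith
    by_cases hmgk : (1 - z) * g * k₂ ≤ S
    · -- upper end `Y = mg`
      have hposY := hXmono ((1 - z) * g) hyg
      exact conclude ((1 - z) * g) hyg
        (qk_lh_T_Y_mg z g lam S k₁ k₂ a hz0 hz1 hg0 hg1 hlam0 hlam1 (by linarith) (by linarith) hmean hD0' hmg0 hW hR2 hmgk hposY)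
        (qk_lh_D_Y_mg z g lam S k₁ k₂ a hz0 hz1 hg0 hg1 hlam0 hlam1 hk₁ hk hKa hmean hD0' hp hW hrho hmgk hposY)
    · -- upper end `Y = S/k₂`
      have hK0 : 0 < k₂ := by linarith
      have hK0' : k₂ ≠ 0 := ne_of_gt hK0
      have hYS : S / k₂ * k₂ = S := div_mul_cancel₀ S hK0'
      have hyY : y ≤ S / k₂ := by rw [le_div_iff₀ hK0]; exact hta
      have hYmg : S / k₂ ≤ (1 - z) * g := by rw [div_le_iff₀ hK0]; linarith
      have hposY := hXmono (S / k₂) hyY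
      have hYS0 : 0 ≤ S / k₂ := by linarith
      have hmg1 : (1 - z) * g ≤ 1 := by
        calc (1 - z) * g ≤ 1 * 1 := mul_le_mul (by linarith) hg1 hg0 (by norm_num)
          _ = 1 := by ring
      have hYS1 : 0 ≤ 1 - S / k₂ := by linarith
      exact conclude (S / k₂) hyY
        (qk_lh_T_Y_sk (S / k₂) z g lam S k₁ k₂ a hz0 hz1 hg0 hg1 hlam0 hlam1 (by linarith) (by linarith) hmean hD0' hmg0 hW hYS hYS0 hYS1 hR2 hYmg hposY)
        (qk_lh_D_Y_sk (S / k₂) z g lam S k₁ k₂ a hz0 hz1 hg0 hg1 hlam0 hlam1 (by linarith) (by linarith) hmean hD0' hmg0 hW hYS hYS0 hYS1 hR2 hYmg hposY)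

end LawDec

end Quant

end Summit.CriticalPhenomena.PercolationContinuityZ3.Theorems
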